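import Literature.AnabelianGeometry.AbsoluteAnabelian.MonoidKummerMapsProp32iH2IsoEqStd
import Literature.AnabelianGeometry.AbsoluteAnabelian.CyclotomicSynchronizationCor110iaIndex
import HarnessLib

/-!
# [AbsTopIII] Rmk 3.2.2 / 1.10.1 (iii) for the `Hom(ℚ/ℤ, −)`-route isomorphism, `Ẑ`-valued:
# restriction is multiplication by the index

S. Mochizuki, *Topics in absolute anabelian geometry III* (2015), Rmk. 3.2.2 p. 73 (= Rmk. 1.10.1 (iii) p. 44):
the functoriality of Prop. 3.2 (i)'s «natural isomorphism `H²(G, μ_Ẑ(M_TM)) ⥲ Ẑ`» «is to be understood in the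
sense of a compatibility, relative to dividing the `Ẑ` … by a factor given by the index of the image of the
induced open homomorphism on arithmetic Galois groups».  Sub-DAG `plan/L4/SUBDAG-AbsTopIII-Prop32.md` row
P32.i.L07; seat abc-iut-w6-d075.

abc-iut-w5-d201 proved this for abc-iut-L4-t17's `lim_i ℤ/(i+1)!`-valued chain
(`limitClassesEquivZModChain_galCyclotomeRes`: `ι_{k′}(Res x) = [k′ : k] · ι_k(x)` in `zmodChain`, and «through ANY
common additive identification» of `zmodChain`).  This file states it for THE `Ẑ`-VALUED isomorphism of print's
own construction — the `Hom(ℚ/ℤ, −)`-route `genuineH2Iso` with the canonical `End(ℚ/ℤ) ≅ Ẑ`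
(`MonoidKummerMapsProp32iGenuineH2.lean`) — for a finite extension `k′/k` of `p`-adic local fields and the
identification of `μ_{ℚ/ℤ}(G_{k′})` INDUCED from a `G_k`-equivariant `φ : μ_{ℚ/ℤ}(G_k) ≅ μ(k̄)`:

* `Prop121vii.genuineH2IsoOfEquiv k φ hφ eEnd` — `genuineH2Iso` with the comparison `(φ, hφ)` as a parameter
  (`genuineH2Iso k R = genuineH2IsoOfEquiv k R.equiv R.equiv_smul`, `rfl`), and its levelwise read-out
  `natCast_dvd_repn_genuineH2IsoOfEquiv_sub_invLevel`;
* **`Prop121vii.genuineH2IsoOfEquiv_galCyclotomeRes`** — `ι^Ẑ_{k′}(Res x) = [k′ : k] • ι^Ẑ_k(x)` in `Ẑ`: the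
  `Ẑ`-valued isomorphisms ARE «compatible with the result of dividing the usual functorially induced morphism by
  the index» (levels from abc-iut-w5-d201's theorem; `Ẑ` is determined by its levels, `ZHatCompletion.eq_of_forall_dvd_repn_cycLevel_sub`).

HONEST SCOPE (as abc-iut-w5-d201's): the identification at `k′` is the INDUCED one; agreement with an
independently furnished identification (e.g. another torsion-reciprocity datum for `k′`) is the naturality of local
reciprocity under restriction (row «F0018-RES-NATURALITY», another seat) and is not asserted.  Classical; nothing
here bears on [IUTchIII] Cor. 3.12 or takes a side; typed ≠ proved.
-/

noncomputable section

namespace Literature.AnabelianGeometry.AbsoluteAnabelian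

open CategoryTheory Field Function
open Literature.NumberTheory.GaloisRepresentations
open Literature.NumberTheory.GaloisRepresentations.DiscreteGaloisModule
open Literature.AnabelianGeometry.SemiGraphs (ZHat)
open Literature.AnabelianGeometry.EtaleTheta (ZHatLevel.level)

namespace Prop121vii

section OfEquiv

variable (k : Type) [Field k] [ValuativeRel k] [TopologicalSpace k] [IsNonarchimedeanLocalField k] [CharZero k]
variable (φ : muQZ (absoluteGaloisGroup k) ≃+ Additive (CommGroup.torsion (AlgebraicClosure k)ˣ))
  (hφ : ∀ (σ : absoluteGaloisGroup k) (x : muQZ (absoluteGaloisGroup k)),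
    (((Additive.toMul (φ (σ • x)) : CommGroup.torsion (AlgebraicClosure k)ˣ) :
        (AlgebraicClosure k)ˣ) : AlgebraicClosure k) =
      σ • (((Additive.toMul (φ x) : CommGroup.torsion (AlgebraicClosure k)ˣ) :
        (AlgebraicClosure k)ˣ) : AlgebraicClosure k))

/-- `H²(Γ_k, μ_Ẑ(G_k)) ⥲ lim_i H²(Γ_k, μ_{(i+1)!}) = H2MuChainClasses k` for ANY equivariant comparison `φ`
(cf. `genuineH2ChainEquiv`, the case `φ = R.equiv`). [cite: MochizukiAbsTopIII2015, Cor 1.10 (i) p.42] -/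
def genuineH2ChainEquivOfEquiv : (galCyclotomeH2 (absoluteGaloisGroup k) : Type) ≃+ H2MuChainClasses k :=
  ((galCyclotomeTower φ hφ).limitClassesEquiv (finite_H1_galCyclotomeTower k φ hφ)).trans
    (AddEquiv.addSubgroupCongr (limitClasses_galCyclotomeTower φ hφ))

/-- `H²(Γ_k, μ_Ẑ(G_k)) ≃ Hom(ℚ/ℤ, H²(Γ_k, μ_{ℚ/ℤ}))` for ANY equivariant comparison `φ`.
[cite: MochizukiAbsTopIII2015, Proposition 3.2 (i) p.71] -/
def genuineH2HomQmodZEquivOfEquiv :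
    (galCyclotomeH2 (absoluteGaloisGroup k) : Type) ≃+ (QmodZ.{0} →+ H2MuQZ k) :=
  (genuineH2ChainEquivOfEquiv k φ hφ).trans
    (H2MuQZ.homQmodZChainEquiv.symm.trans (AddEquiv.addMonoidHomCongrLeft AddEquiv.ulift.symm))

/-- Its value at `1/(i+1)!` is `of` (the level-`(i+1)!` class). [cite: MochizukiAbsTopIII2015, Proposition 3.2 (i) p.71] -/
theorem genuineH2HomQmodZEquivOfEquiv_apply_up (c : (galCyclotomeH2 (absoluteGaloisGroup k) : Type)) (i : ℕ) :
    genuineH2HomQmodZEquivOfEquiv k φ hφ c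
        (ULift.up ((((1 : ℚ) / ((cycLevel i : ℕ+) : ℕ) : ℚ)) : AddCircle (1 : ℚ))) =
      H2MuQZ.of (cycLevel i) (cohomologyMap ((galCyclotomeTower φ hφ).proj i) 2 c) := by
  change H2MuChainClasses.toHomQmodZ (genuineH2ChainEquivOfEquiv k φ hφ c)
      ((((1 : ℚ) / ((cycLevel i : ℕ+) : ℕ) : ℚ)) : AddCircle (1 : ℚ)) = _
  rw [H2MuChainClasses.toHomQmodZ_apply_coe_one_div_cycLevel]
  rfl

/-- **The `Hom(ℚ/ℤ, −)`-route `Ẑ`-valued isomorphism for ANY equivariant comparison `φ`**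
(`genuineH2Iso` is the case `φ = R.equiv`). [cite: MochizukiAbsTopIII2015, Proposition 3.2 (i) p.71] -/
def genuineH2IsoOfEquiv (eEnd : (QmodZ.{0} →+ QmodZ.{0}) ≃+ ZhatAdd.{0}) :
    (galCyclotomeH2 (absoluteGaloisGroup k) : Type) ≃+ ZhatAdd.{0} :=
  (genuineH2HomQmodZEquivOfEquiv k φ hφ).trans
    ((AddEquiv.addMonoidHomCongrRight ((invariantQZEquiv k).trans AddEquiv.ulift.symm)).trans eEnd)

/-- `genuineH2Iso k R` IS `genuineH2IsoOfEquiv k R.equiv R.equiv_smul` (definitional).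
[cite: MochizukiAbsTopIII2015, Proposition 3.2 (i) p.71] -/
theorem genuineH2Iso_eq_ofEquiv (R : TorsionReciprocityData k) (eEnd : (QmodZ.{0} →+ QmodZ.{0}) ≃+ ZhatAdd.{0}) :
    genuineH2Iso k R eEnd = genuineH2IsoOfEquiv k R.equiv R.equiv_smul eEnd := rfl

/-- **Levelwise read-out** (general `φ`): the `ℤ/(i+1)!`-coordinate of `genuineH2IsoOfEquiv … endQmodZCanonical c`
is `inv_{(i+1)!}` of the level class — i.e. the `i`-th component of abc-iut-L4-t17's
`limitClassesEquivZModChain (limitClassesEquiv c)`. [cite: MochizukiAbsTopIII2015, Cor 1.10 (i) p.42] -/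
theorem natCast_dvd_repn_genuineH2IsoOfEquiv_sub_zmodChain
    (c : (galCyclotomeH2 (absoluteGaloisGroup k) : Type)) (i : ℕ) :
    ((((cycLevel i : ℕ+) : ℕ) : ℤ)) ∣
      @ZHatCompletion.repn ((cycLevel i : ℕ+) : ℕ) ⟨(cycLevel i).ne_zero⟩
          (Additive.toMul (genuineH2IsoOfEquiv k φ hφ Prop32iChain.endQmodZCanonical c).down) -
        (((limitClassesEquivZModChain k φ hφ
          ((galCyclotomeTower φ hφ).limitClassesEquiv (finite_H1_galCyclotomeTower k φ hφ) c)).1 i).val : ℤ) := by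
  haveI : NeZero ((cycLevel i : ℕ+) : ℕ) := ⟨(cycLevel i).ne_zero⟩
  let ψ : AddCircle (1 : ℚ) →+ AddCircle (1 : ℚ) :=
    (AddEquiv.ulift : QmodZ.{0} ≃+ AddCircle (1 : ℚ)).addMonoidHomCongrRight
      ((AddEquiv.ulift : QmodZ.{0} ≃+ AddCircle (1 : ℚ)).addMonoidHomCongrLeft
        ((AddEquiv.addMonoidHomCongrRight
          ((invariantQZEquiv k).trans (AddEquiv.ulift : QmodZ.{0} ≃+ AddCircle (1 : ℚ)).symm))
          (genuineH2HomQmodZEquivOfEquiv k φ hφ c)))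
  have h1 : (genuineH2IsoOfEquiv k φ hφ Prop32iChain.endQmodZCanonical c).down =
      Additive.ofMul (ZHatCompletion.ofEnd ψ) := rfl
  have h2 : ψ ((((1 : ℚ) / ((cycLevel i : ℕ+) : ℕ) : ℚ)) : AddCircle (1 : ℚ)) =
      ((invLevel k ((cycLevel i : ℕ+) : ℕ)
          (cohomologyMap ((galCyclotomeTower φ hφ).proj i) 2 c)).val : ℤ) •
        ((((1 : ℚ) / ((cycLevel i : ℕ+) : ℕ) : ℚ)) : AddCircle (1 : ℚ)) := by
    change invariantQZ k (genuineH2HomQmodZEquivOfEquiv k φ hφ c (ULift.up _)) = _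
    rw [genuineH2HomQmodZEquivOfEquiv_apply_up, invariantQZ_of, ← AddCircle.coe_zsmul, zsmul_eq_mul,
      Int.cast_natCast, mul_one_div]
  have h3 := ZHatCompletion.apply_inv_eq_coeff_zsmul ψ (cycLevel i).pos
  rw [h2, ← sub_eq_zero, ← sub_smul] at h3
  have h4 := natCast_dvd_of_zsmul_coe_one_div_eq_zero (cycLevel i).pos h3
  have h5 := ZHatCompletion.dvd_repn_ofEnd_sub_coeff ψ ((cycLevel i : ℕ+) : ℕ)
  rw [h1, toMul_ofMul]
  have := h5.add (dvd_sub_comm.1 h4)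
  rwa [sub_add_sub_cancel] at this

/-- The same read through abc-iut-L2's level character `ZHatLevel.level`.
[cite: MochizukiAbsTopIII2015, Cor 1.10 (i) p.42] -/
theorem toAdd_level_genuineH2IsoOfEquiv (c : (galCyclotomeH2 (absoluteGaloisGroup k) : Type)) (i : ℕ) :
    Multiplicative.toAdd (ZHatLevel.level (cycLevel i)
        (Additive.toMul (genuineH2IsoOfEquiv k φ hφ Prop32iChain.endQmodZCanonical c).down)) =
      (limitClassesEquivZModChain k φ hφ
        ((galCyclotomeTower φ hφ).limitClassesEquiv (finite_H1_galCyclotomeTower k φ hφ) c)).1 i := by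
  rw [ZHatCompletion.toAdd_level_eq_intCast_repn, ← ZMod.natCast_zmod_val ((limitClassesEquivZModChain k φ hφ _).1 i),
    ← Int.cast_natCast]
  exact (ZMod.intCast_eq_intCast_iff_dvd_sub _ _ _).2
    (dvd_sub_comm.1 (natCast_dvd_repn_genuineH2IsoOfEquiv_sub_zmodChain k φ hφ c i))

end OfEquiv

/-! ### Restriction to a finite extension: «dividing by the index», `Ẑ`-valued -/

section Index

variable (k k' : Type) [Field k] [ValuativeRel k] [TopologicalSpace k] [IsNonarchimedeanLocalField k]
  [CharZero k] [Field k'] [ValuativeRel k'] [TopologicalSpace k'] [IsNonarchimedeanLocalField k']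
  [CharZero k'] [Algebra k k'] [FiniteDimensional k k']
  (φ : muQZ (absoluteGaloisGroup k) ≃+ Additive (CommGroup.torsion (AlgebraicClosure k)ˣ))
  (hφ : ∀ (σ : absoluteGaloisGroup k) (x : muQZ (absoluteGaloisGroup k)),
    (((Additive.toMul (φ (σ • x)) : CommGroup.torsion (AlgebraicClosure k)ˣ) :
        (AlgebraicClosure k)ˣ) : AlgebraicClosure k) =
      σ • (((Additive.toMul (φ x) : CommGroup.torsion (AlgebraicClosure k)ˣ) :
        (AlgebraicClosure k)ˣ) : AlgebraicClosure k))

/-- Level characters are additive on `Ẑ` read additively: `level (toMul (d • z)) = (level (toMul z))^d`.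
[cite: RibesZalesskii2010, Thm 2.7.1] -/
theorem toAdd_level_toMul_nsmul (n : ℕ+) (d : ℕ) (z : Additive ZHat) :
    Multiplicative.toAdd (ZHatLevel.level n (Additive.toMul (d • z))) =
      d • Multiplicative.toAdd (ZHatLevel.level n (Additive.toMul z)) := by
  rw [toMul_nsmul, map_pow, toAdd_pow]

/-- **[AbsTopIII] Rmk. 3.2.2 / 1.10.1 (iii) for THE `Ẑ`-valued `Hom(ℚ/ℤ, −)`-route isomorphism**: for a finite
extension `k′/k` of `p`-adic local fields, the restriction `Res : H²(Γ_k, μ_Ẑ(G_k)) → H²(Γ_{k′}, μ_Ẑ(G_{k′}))`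
(abc-iut-w5-d201's `galCyclotomeRes`) satisfies `ι^Ẑ_{k′}(Res x) = [k′ : k] • ι^Ẑ_k(x)` in `Ẑ`, `ι^Ẑ` the
isomorphisms `genuineH2IsoOfEquiv` at `φ` and at the INDUCED `inducedCyclotomeEquiv k k′ φ`, with the canonical
`End(ℚ/ℤ) ≅ Ẑ`. [cite: MochizukiAbsTopIII2015, Remark 3.2.2 p.73] -/
theorem genuineH2IsoOfEquiv_galCyclotomeRes (x : (galCyclotomeH2 (absoluteGaloisGroup k) : Type)) :
    genuineH2IsoOfEquiv k' (inducedCyclotomeEquiv k k' φ) (inducedCyclotomeEquiv_smul k k' φ hφ)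
        Prop32iChain.endQmodZCanonical ((galCyclotomeRes k k' 2).hom x) =
      Module.finrank k k' • genuineH2IsoOfEquiv k φ hφ Prop32iChain.endQmodZCanonical x := by
  apply ULift.ext
  apply Additive.toMul.injective
  refine ZHatCompletion.eq_of_forall_dvd_repn_cycLevel_sub fun i => ?_
  haveI : NeZero ((cycLevel i : ℕ+) : ℕ) := ⟨(cycLevel i).ne_zero⟩
  -- left: level `(i+1)!` is component `i` of `ι_{k′}(Res x)` = `[k′:k] · (ι_k x)_i` (abc-iut-w5-d201)
  have hL := toAdd_level_genuineH2IsoOfEquiv k' (inducedCyclotomeEquiv k k' φ)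
    (inducedCyclotomeEquiv_smul k k' φ hφ) ((galCyclotomeRes k k' 2).hom x) i
  rw [limitClassesEquivZModChain_galCyclotomeRes k k' φ hφ x, zmodChain_coe_nsmul_apply] at hL
  -- right: level `(i+1)!` of `[k′:k] • ι^Ẑ_k x` is `[k′:k] · (ι_k x)_i`
  have hR : Multiplicative.toAdd (ZHatLevel.level (cycLevel i) (Additive.toMul
      (Module.finrank k k' • genuineH2IsoOfEquiv k φ hφ Prop32iChain.endQmodZCanonical x).down)) =
      (Module.finrank k k' : ZMod ((cycLevel i : ℕ+) : ℕ)) *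
        (limitClassesEquivZModChain k φ hφ
          ((galCyclotomeTower φ hφ).limitClassesEquiv (finite_H1_galCyclotomeTower k φ hφ) x)).1 i := by
    rw [ULift.smul_down, toAdd_level_toMul_nsmul, toAdd_level_genuineH2IsoOfEquiv, nsmul_eq_mul]
  have h := hL.trans hR.symm
  rw [ZHatCompletion.toAdd_level_eq_intCast_repn, ZHatCompletion.toAdd_level_eq_intCast_repn] at h
  exact (ZMod.intCast_eq_intCast_iff_dvd_sub _ _ _).1 h.symm

/-- The same for the torsion-reciprocity form at `k` (`genuineH2Iso k R`, as used by the Prop. 3.2 (i) chains).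
[cite: MochizukiAbsTopIII2015, Remark 3.2.2 p.73] -/
theorem genuineH2IsoOfEquiv_galCyclotomeRes_of_data (R : TorsionReciprocityData k)
    (x : (galCyclotomeH2 (absoluteGaloisGroup k) : Type)) :
    genuineH2IsoOfEquiv k' (inducedCyclotomeEquiv k k' R.equiv) (inducedCyclotomeEquiv_smul k k' R.equiv R.equiv_smul)
        Prop32iChain.endQmodZCanonical ((galCyclotomeRes k k' 2).hom x) =
      Module.finrank k k' • genuineH2Iso k R Prop32iChain.endQmodZCanonical x :=
  genuineH2IsoOfEquiv_galCyclotomeRes k k' R.equiv R.equiv_smul x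

end Index

end Prop121vii

end Literature.AnabelianGeometry.AbsoluteAnabelian

end
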